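import Mathlib
import HarnessLib
import Summits.Ventures.LatticeQCDFlow.Exactness.ChargeSlabCorrelatorRP

/-!
# The Schwarz inequality of reflection positivity for slab charges: the magnitude of the (non-positive) slab-charge correlator is MIDPOINT LOG-CONVEX across the reflection planes

HONEST FRAMING: exact (Metropolis-corrected) sampling algorithms for lattice gauge theory;
figures of merit are autocorrelation/cost numbers at stated couplings and volumes; no
continuum-physics claim.

Venture `LatticeQCDFlow` (cell pub-lqcd), topic `Exactness`, FANOUT row 21 (`su3-base`).  NEW WORK of the cell, def-free, the
sequel of row 21's `Exactness/ChargeSlabCorrelatorRP` (`⟨Q_m Q_{1−m}⟩_β ≤ 0`, `⟨Q_m Q_{−m}⟩_β ≤ 0` for the time-slice clover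
charges `Q_t = Σ_{x₀ = t} P_x`): the Osterwalder–Schrader form `(A, B) ↦ ∫ A · B∘Θ` is a non-negative symmetric bilinear form on
the half-space observables, so it satisfies the Schwarz inequality (the Literature's
`FariaDaVeigaOCarroll2022.MultiReflection.sq_integral_mul_comp_le_of_rp`, Fröhlich–Israel–Lieb–Simon 1978 Thm 2.1, applied with the
Literature's `timeReflectEquiv` / `WilsonSiteRP.negReflectEquiv` and their measure preservation).  With `Q_{m'}∘Θ = −Q_{1−m'}` this reads
`⟨Q_m Q_{1−m'}⟩² ≤ ⟨Q_m Q_{1−m}⟩·⟨Q_{m'} Q_{1−m'}⟩` — in separations: `D(s'')² ≤ D(s)·D(s')` for `D = −C ≥ 0`, `s = 2m − 1`,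
`s' = 2m' − 1`, `s'' = m + m' − 1 = (s + s')/2`; the same across the site plane with `s = 2m`, `s' = 2m'`, `s'' = m + m'`.
Nothing is cited as a fact; no number.  (Row 30's `Scaling/PlaquetteCorrelatorLogConvex` is the `0⁺⁺` plaquette analogue.)

* **`sq_integral_slabCharge_timeReflect_le`** — `β ≥ 0`, even `L`, `2 ≤ m, m' ≤ L/2 − 1`:
  `(∫ Q_m Q_{1−m'})² ≤ (∫ Q_m Q_{1−m})·(∫ Q_{m'} Q_{1−m'})`.
* **`sq_integral_slabCharge_negReflect_le`** — every `β`, even `L`, `1 ≤ m, m' ≤ L/2 − 1`: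
  `(∫ Q_m Q_{−m'})² ≤ (∫ Q_m Q_{−m})·(∫ Q_{m'} Q_{−m'})`.
In words: along either parity class of separations reachable from a plane, `|C(s)|` at the midpoint is at most the geometric
mean of the endpoints — the negative tail of the slab-charge correlator cannot bulge.  NOT CLAIMED: monotonicity in `s` (needs
`|C| → 0`, an infinite-volume statement); mixed parities; the translation to arbitrary base slices (`Scoring/SlabChargeDecomposition`);
numbers.
-/

noncomputable section

namespace Summit.Ventures.LatticeQCDFlow.Exactness

open MeasureTheory
open Literature.MathematicalPhysics.QuantumFieldTheory
open Literature.MathematicalPhysics.QuantumFieldTheory.FariaDaVeigaOCarroll2022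
open Literature.MathematicalPhysics.QuantumFieldTheory.FariaDaVeigaOCarroll2022.MultiReflection
open Literature.MathematicalPhysics.QuantumLattice (cloverPseudoscalar)

variable {L N : ℕ} [NeZero L] [Fact (1 < L)] {G : Type*} [Group G] [TopologicalSpace G] [IsTopologicalGroup G]
  [CompactSpace G] [MeasurableSpace G] [BorelSpace G] [SecondCountableTopology G] (ρ : G →* Matrix (Fin N) (Fin N) ℂ)

omit [IsTopologicalGroup G] in
/-- The slab charge `Q_m` (`2 ≤ m ≤ L/2 − 1`) is measurable, bounded and an observable of the positive-time links. -/
theorem slabCharge_admissible_link (hρc : Continuous ρ) {m : ℕ} (h2 : 2 ≤ m) (hm : m + 1 ≤ L / 2) :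
    Measurable (fun U : GaugeConfig 4 L G =>
        ∑ x ∈ Finset.univ.filter (fun x : Site 4 L => x 0 = (m : ZMod L)), cloverPseudoscalar ρ x U) ∧
      (∃ K : ℝ, ∀ U : GaugeConfig 4 L G,
        |∑ x ∈ Finset.univ.filter (fun x : Site 4 L => x 0 = (m : ZMod L)), cloverPseudoscalar ρ x U| ≤ K) ∧
      DependsOn (fun U : GaugeConfig 4 L G =>
        ∑ x ∈ Finset.univ.filter (fun x : Site 4 L => x 0 = (m : ZMod L)), cloverPseudoscalar ρ x U)
        {e : Edge 4 L | WilsonRP.IsPosEdge e} := by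
  have hL1 : 1 < L := Fact.out
  obtain ⟨hFm, hFb⟩ := measurable_bounded_sum_cloverPseudoscalar ρ hρc
    (Finset.univ.filter (fun x : Site 4 L => x 0 = (m : ZMod L))) (fun _ => (1 : ℝ)) id
  simp only [id, one_mul] at hFm hFb
  refine ⟨hFm, hFb, fun U V hUV => Finset.sum_congr rfl fun x hx => ?_⟩
  have hx0 : x 0 = (m : ZMod L) := by simpa using hx
  have h := dependsOn_cloverPseudoscalar_posEdges ρ x hx0 h2 hm (by omega) hUV
  simpa using h

omit [IsTopologicalGroup G] in
/-- The slab charge `Q_m` (`1 ≤ m ≤ L/2 − 1`) is measurable, bounded and an observable of the site-positive / shared links. -/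
theorem slabCharge_admissible_site (hρc : Continuous ρ) {m : ℕ} (h1 : 1 ≤ m) (hm : m + 1 ≤ L / 2) :
    Measurable (fun U : GaugeConfig 4 L G =>
        ∑ x ∈ Finset.univ.filter (fun x : Site 4 L => x 0 = (m : ZMod L)), cloverPseudoscalar ρ x U) ∧
      (∃ K : ℝ, ∀ U : GaugeConfig 4 L G,
        |∑ x ∈ Finset.univ.filter (fun x : Site 4 L => x 0 = (m : ZMod L)), cloverPseudoscalar ρ x U| ≤ K) ∧
      DependsOn (fun U : GaugeConfig 4 L G =>
        ∑ x ∈ Finset.univ.filter (fun x : Site 4 L => x 0 = (m : ZMod L)), cloverPseudoscalar ρ x U)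
        ((WilsonSiteRP.sitePosEdges ∪ WilsonSiteRP.sharedEdges : Finset (Edge 4 L)) : Set (Edge 4 L)) := by
  have hL1 : 1 < L := Fact.out
  obtain ⟨hFm, hFb⟩ := measurable_bounded_sum_cloverPseudoscalar ρ hρc
    (Finset.univ.filter (fun x : Site 4 L => x 0 = (m : ZMod L))) (fun _ => (1 : ℝ)) id
  simp only [id, one_mul] at hFm hFb
  refine ⟨hFm, hFb, fun U V hUV => Finset.sum_congr rfl fun x hx => ?_⟩
  have hx0 : x 0 = (m : ZMod L) := by simpa using hx
  have h := dependsOn_cloverPseudoscalar_sitePosEdges ρ x hx0 h1 hm (by omega) hUV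
  simpa using h

/-- **SCHWARZ ACROSS THE LINK PLANE: `(∫ Q_m Q_{1−m'})² ≤ (∫ Q_m Q_{1−m})·(∫ Q_{m'} Q_{1−m'})`** for `β ≥ 0`, even `L`,
`2 ≤ m, m' ≤ L/2 − 1` — in separations `D((s+s')/2)² ≤ D(s)D(s')`, `s = 2m − 1`, `s' = 2m' − 1`, `D = −C ≥ 0`. -/
theorem sq_integral_slabCharge_timeReflect_le (hL : Even L) (hρc : Continuous ρ)
    (hρu : ∀ g, ρ g ∈ Matrix.unitaryGroup (Fin N) ℂ) {β : ℝ} (hβ : 0 ≤ β) {m m' : ℕ} (h2 : 2 ≤ m) (hm : m + 1 ≤ L / 2)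
    (h2' : 2 ≤ m') (hm' : m' + 1 ≤ L / 2) :
    (∫ U, (∑ x ∈ Finset.univ.filter (fun x : Site 4 L => x 0 = (m : ZMod L)), cloverPseudoscalar ρ x U) *
        (∑ x ∈ Finset.univ.filter (fun x : Site 4 L => x 0 = 1 - (m' : ZMod L)), cloverPseudoscalar ρ x U)
        ∂(wilsonMeasure ρ β)) ^ 2 ≤
      (∫ U, (∑ x ∈ Finset.univ.filter (fun x : Site 4 L => x 0 = (m : ZMod L)), cloverPseudoscalar ρ x U) *
          (∑ x ∈ Finset.univ.filter (fun x : Site 4 L => x 0 = 1 - (m : ZMod L)), cloverPseudoscalar ρ x U)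
          ∂(wilsonMeasure ρ β)) *
        (∫ U, (∑ x ∈ Finset.univ.filter (fun x : Site 4 L => x 0 = (m' : ZMod L)), cloverPseudoscalar ρ x U) *
          (∑ x ∈ Finset.univ.filter (fun x : Site 4 L => x 0 = 1 - (m' : ZMod L)), cloverPseudoscalar ρ x U)
          ∂(wilsonMeasure ρ β)) := by
  haveI := isProbabilityMeasure_wilsonMeasure (d := 4) (L := L) ρ hρc β
  obtain ⟨hAm, hAb, hA⟩ := slabCharge_admissible_link ρ hρc h2 hm
  obtain ⟨hBm, hBb, hB⟩ := slabCharge_admissible_link ρ hρc h2' hm'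
  have hadm : ∀ (A B : GaugeConfig 4 L G → ℝ) (t : ℝ), DependsOn A {e : Edge 4 L | WilsonRP.IsPosEdge e} →
      DependsOn B {e : Edge 4 L | WilsonRP.IsPosEdge e} →
      DependsOn (fun U => A U + t * B U) {e : Edge 4 L | WilsonRP.IsPosEdge e} :=
    fun A B t hA hB U V hUV => by simp only [hA hUV, hB hUV]
  have key := sq_integral_mul_comp_le_of_rp (μ := wilsonMeasure ρ β) timeReflectEquiv
    (measurePreserving_timeReflectEquiv ρ hρc β)
    (fun U => (timeReflectEquiv (d := 4) (L := L) (G := G)).left_inv U)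
    (fun F => DependsOn F {e : Edge 4 L | WilsonRP.IsPosEdge e}) hadm
    (fun F hF hFm hFb => integral_mul_timeReflect_nonneg ρ hL hρc hβ hFm hFb hF) hA hB hAm hBm hAb hBb
  -- identify `Q_k ∘ Θ = −Q_{1−k}`
  have happ : ∀ U : GaugeConfig 4 L G,
      (timeReflectEquiv : GaugeConfig 4 L G ≃ᵐ GaugeConfig 4 L G) U = U.timeReflect := fun U => rfl
  have hre : ∀ (k : ℕ) (U : GaugeConfig 4 L G),
      ∑ x ∈ Finset.univ.filter (fun x : Site 4 L => x 0 = (k : ZMod L)), cloverPseudoscalar ρ x (timeReflectEquiv U) =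
        -∑ x ∈ Finset.univ.filter (fun x : Site 4 L => x 0 = 1 - (k : ZMod L)), cloverPseudoscalar ρ x U := by
    intro k U
    rw [happ, ← sum_slab_timeReflect (k : ZMod L) (fun x => cloverPseudoscalar ρ x U), ← Finset.sum_neg_distrib]
    exact Finset.sum_congr rfl fun x _ => cloverPseudoscalar_timeReflect ρ hρu U x
  simp only [hre, mul_neg, integral_neg, neg_mul, neg_neg, neg_sq] at key
  exact key

/-- **SCHWARZ ACROSS THE SITE PLANE: `(∫ Q_m Q_{−m'})² ≤ (∫ Q_m Q_{−m})·(∫ Q_{m'} Q_{−m'})`** for every `β`, even `L`,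
`1 ≤ m, m' ≤ L/2 − 1` — in separations `D((s+s')/2)² ≤ D(s)D(s')`, `s = 2m`, `s' = 2m'`. -/
theorem sq_integral_slabCharge_negReflect_le (hL : Even L) (hρc : Continuous ρ)
    (hρu : ∀ g, ρ g ∈ Matrix.unitaryGroup (Fin N) ℂ) (β : ℝ) {m m' : ℕ} (h1 : 1 ≤ m) (hm : m + 1 ≤ L / 2)
    (h1' : 1 ≤ m') (hm' : m' + 1 ≤ L / 2) :
    (∫ U, (∑ x ∈ Finset.univ.filter (fun x : Site 4 L => x 0 = (m : ZMod L)), cloverPseudoscalar ρ x U) *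
        (∑ x ∈ Finset.univ.filter (fun x : Site 4 L => x 0 = -(m' : ZMod L)), cloverPseudoscalar ρ x U)
        ∂(wilsonMeasure ρ β)) ^ 2 ≤
      (∫ U, (∑ x ∈ Finset.univ.filter (fun x : Site 4 L => x 0 = (m : ZMod L)), cloverPseudoscalar ρ x U) *
          (∑ x ∈ Finset.univ.filter (fun x : Site 4 L => x 0 = -(m : ZMod L)), cloverPseudoscalar ρ x U)
          ∂(wilsonMeasure ρ β)) *
        (∫ U, (∑ x ∈ Finset.univ.filter (fun x : Site 4 L => x 0 = (m' : ZMod L)), cloverPseudoscalar ρ x U) *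
          (∑ x ∈ Finset.univ.filter (fun x : Site 4 L => x 0 = -(m' : ZMod L)), cloverPseudoscalar ρ x U)
          ∂(wilsonMeasure ρ β)) := by
  haveI := isProbabilityMeasure_wilsonMeasure (d := 4) (L := L) ρ hρc β
  obtain ⟨hAm, hAb, hA⟩ := slabCharge_admissible_site ρ hρc h1 hm
  obtain ⟨hBm, hBb, hB⟩ := slabCharge_admissible_site ρ hρc h1' hm'
  have hadm : ∀ (A B : GaugeConfig 4 L G → ℝ) (t : ℝ),
      DependsOn A ((WilsonSiteRP.sitePosEdges ∪ WilsonSiteRP.sharedEdges : Finset (Edge 4 L)) : Set (Edge 4 L)) →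
      DependsOn B ((WilsonSiteRP.sitePosEdges ∪ WilsonSiteRP.sharedEdges : Finset (Edge 4 L)) : Set (Edge 4 L)) →
      DependsOn (fun U => A U + t * B U)
        ((WilsonSiteRP.sitePosEdges ∪ WilsonSiteRP.sharedEdges : Finset (Edge 4 L)) : Set (Edge 4 L)) :=
    fun A B t hA hB U V hUV => by simp only [hA hUV, hB hUV]
  have key := sq_integral_mul_comp_le_of_rp (μ := wilsonMeasure ρ β) WilsonSiteRP.negReflectEquiv
    (measurePreserving_negReflectEquiv ρ hL hρc β)
    (fun U => (WilsonSiteRP.negReflectEquiv (d := 4) (L := L) (G := G)).left_inv U)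
    (fun F => DependsOn F ((WilsonSiteRP.sitePosEdges ∪ WilsonSiteRP.sharedEdges : Finset (Edge 4 L)) : Set (Edge 4 L)))
    hadm (fun F hF hFm hFb => integral_mul_negReflect_nonneg ρ hL hρc β hFm hFb hF) hA hB hAm hBm hAb hBb
  have happ : ∀ U : GaugeConfig 4 L G,
      (WilsonSiteRP.negReflectEquiv : GaugeConfig 4 L G ≃ᵐ GaugeConfig 4 L G) U = U.negReflect := fun U => rfl
  have hre : ∀ (k : ℕ) (U : GaugeConfig 4 L G),
      ∑ x ∈ Finset.univ.filter (fun x : Site 4 L => x 0 = (k : ZMod L)), cloverPseudoscalar ρ x (WilsonSiteRP.negReflectEquiv U) =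
        -∑ x ∈ Finset.univ.filter (fun x : Site 4 L => x 0 = -(k : ZMod L)), cloverPseudoscalar ρ x U := by
    intro k U
    rw [happ, ← sum_slab_negReflect (k : ZMod L) (fun x => cloverPseudoscalar ρ x U), ← Finset.sum_neg_distrib]
    exact Finset.sum_congr rfl fun x _ => cloverPseudoscalar_negReflect ρ hρu U x
  simp only [hre, mul_neg, integral_neg, neg_mul, neg_neg, neg_sq] at key
  exact key

end Summit.Ventures.LatticeQCDFlow.Exactness
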